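import Summits.QuantumFields.YangMills.Theorems.UnitScaleTiltFluctuationComparisonRegPrRestrictedLowerStep
import Literature.MathematicalPhysics.QuantumFieldTheory.Balaban1983to89.T3AvgDivergenceSplit
import HarnessLib

/-!
# Route `UnitScaleTilt` — crux `FluctuationComparisonRegPrL` (stmt-QuantumFields-19935), STUB 3′ `stub_alphaTwoRunOfLane`, ADAPTER CONJUNCT
# `RepAtHeights` FOR THE CANONICAL v2 DATUM, PART 2: (47) FOR THE RESTRICTED HEIGHT DENSITY at every height and THE LOWER HALF of
# `RepAtHeights`'s a.e. clause in log form — support file `--supports stmt-QuantumFields-19935`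

Fleet lead `ym-ust-19201-p1` (gen 4).  Part 1 (`…RestrictedLowerStep`) supplies the one-step lower envelope `ℓ_{j+1} ≤ T_j(𝟙_{window j}·ℓ_j)`,
`ℓ_j := e^{−Ecst_j − Rm_j}·low_j`, from the (α) rows; here it is propagated along Bałaban's small-field recursion by the frame
`LogComparisonSmallFieldEnvelope.heightDensity_sandwich_of_oneStep` (p452326; upper envelopes := the unrestricted density, which propagates by
monotonicity of `T_j`), and read in the currency of `T3LogComparisonSocket.TwoSidedRepAt`.

* §5 `dataT3c_restricted47` — for `n ≤ K`, a.e. on the window `PlaqSmall (θBal n)`: `e^{−Ecst_k − Rm_k}·low_k(fieldShift V) ≤ heightDensity F γ _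
  (histGood … K n) V ≤ resDensity F γ K univ k (fieldShift V)`, `k = K − n` — print's (47) p.267 for the term WITHOUT large fields, which is what the
  inductive proof p.272 L32–33 establishes, for the route's `blockAvg ℰp` tower, modulo the rows.
* §6 `dataT3c_repAtHeights_lower_of_id` / `dataT3c_repAtHeights_lower` (`n < K`, thresholds `θBal(n) ≤ a₁`, `B₃θBal(n) ≤ ε₀ ≤ a₀`, minimiser row
  `dataT3c_uminTriv`) / `dataT3c_repAtHeights_lower_top` (`n = K`, `θBal(K) ≤ ε₀`, `4θBal(K) < ε₀`): a.e. on the window the restricted height density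
  is POSITIVE and `−D.RmH K n ≤ log ρ(V) + β_K·minActionRegPr F n K _ ε₀ V − D.PintH K n V + D.EcstH K n` — the (47)-direction of the a.e. clause of
  `RepAtHeights (dataT3c …) 𝔠.b₀ 𝔠.p₀ ε₀`.
WHAT IS NOT HERE (located; seat STATUS 2026-08-27): the (41)-direction.  For the restricted density it follows from the row `fibre49` at the trivial
new history ONLY with the lane's trivial-history mass `m_k(triv) = max 1 (T_{k−1}[m_{k−1}(triv)])` (`MassesAC`; `stepWeight_triv = 1`, so it is the
floored iterated Jacobian of `blockAvg ℰp`, finding F-α1-1) as an extra factor, which `RepAtHeights` as typed does not carry (exact Haar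
compatibility of the averaging would make it `1`).  CONDITIONAL on the (α) rows; nothing of [Balaban1985UV3]/[Balaban1985Variational] is asserted.

References: T. Bałaban, Commun. Math. Phys. 102 (1985) 255–275 [Balaban1985UV3] ((1) p.256, (41)–(42) p.266, (47) p.267, p.272 L32–33); Commun.
Math. Phys. 102 (1985) 277–309 [Balaban1985Variational] ((2), (6) p.278, Thm 1 (8) p.279).
-/

set_option autoImplicit false

noncomputable section

namespace Summit.QuantumFields.YangMills.Theorems.RepAtHeightsAdapter

open MeasureTheory Filter
open Literature.MathematicalPhysics.QuantumFieldTheory.Balaban1983to89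
open Literature.MathematicalPhysics.QuantumFieldTheory.Balaban1983to89.B10 (TowerRun Ineq41 Ineq47)
open Literature.MathematicalPhysics.QuantumFieldTheory.Balaban1983to89.B10SectAGathering (StepPieces StepLeaves)
open Literature.MathematicalPhysics.QuantumFieldTheory.Balaban1983to89.AveragingRT (rnTransport)
open Literature.MathematicalPhysics.QuantumFieldTheory.Balaban1983to89.T3ContinuumYM3Torus
open Literature.MathematicalPhysics.QuantumFieldTheory.Balaban1983to89.T3UnitLawDensityEML (ℰp measurableE_ℰp measurable_blockAvg haarAC_blockAvg rt)
open Literature.MathematicalPhysics.QuantumFieldTheory.Balaban1983to89.T3UnitScaleTilt (θBal histGood measurableSet_plaqSmall)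
open Literature.MathematicalPhysics.QuantumFieldTheory.Balaban1983to89.T3LevelShift (fieldShift)
open Literature.MathematicalPhysics.QuantumFieldTheory.Balaban1983to89.T3RestrictedUnitDensity (towerDensity resDensity towerDensity_succ integrable_resDensity resDensity_nonneg)
open Literature.MathematicalPhysics.QuantumFieldTheory.Balaban1983to89.T3TiltDescent (heightDensity)
open Literature.MathematicalPhysics.QuantumFieldTheory.Balaban1983to89.T3PrintedRegularMinimiser (regFibrePr minActionRegPr RegPr
  mem_regFibrePr_iff minActionRegPr_le)
open Literature.MathematicalPhysics.QuantumFieldTheory.Balaban1983to89.T3AvgDivergenceSplit (regPr_of_plaqSmall)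
open Literature.MathematicalPhysics.QuantumFieldTheory.Balaban1983to89.T3DescentFibreTower (fibre_self)
open Literature.MathematicalPhysics.QuantumFieldTheory.Balaban1983to89.T3CruxEstimates (plaqSmall_fieldShift)
open Literature.MathematicalPhysics.QuantumFieldTheory.Balaban1983to89.T3AlphaInputsAC
open Literature.MathematicalPhysics.QuantumFieldTheory.Balaban1983to89.Missing (boltzmann)
open Literature.MathematicalPhysics.QuantumFieldTheory.Balaban1985CMP102
open Literature.MathematicalPhysics.QuantumFieldTheory.Balaban1985CMP102.Setting
open Summit.QuantumFields.Balaban3D.Carriers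
open Summit.QuantumFields.Balaban3D.Proofs.Primitives
open Summit.QuantumFields.Balaban3D.Proofs.TowerAC
open Summit.QuantumFields.Balaban3D.Proofs.StandardAC
open Summit.QuantumFields.Balaban3D.Proofs.InputsAC
open Summit.QuantumFields.Balaban3D.Proofs.AlphaAC
open Summit.QuantumFields.Balaban3D.Proofs.Bound55AC (hint47_stdAC)
open Summit.QuantumFields.Balaban3D.Proofs.Thm2AC
open Summit.QuantumFields.YangMills.Theorems.LogComparisonSmallFieldRecursion
open Summit.QuantumFields.YangMills.Theorems.LogComparisonSmallFieldEnvelope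

/-! ## §5 (47) for the RESTRICTED height density of the v2 datum -/

section Restricted

variable {F : T3Family} {𝔠 : AlphaConsts F.L (suGroupModel 2).N} {a₀ a₁ : ℝ}
  (h : AlphaInputsT3AC.OfV2At F 𝔠 a₀ a₁) (hc : 0 < a₀ ∧ 0 < a₁ ∧ 𝔠.B₃ * a₁ ≤ a₀) (γ : ℝ) (hγ : 0 < γ)
  (hγ1 : γ ≤ (min 𝔠.gamma0 1) ^ 2) (π : AlphaInputsT3AC.PolymerT3 F)

/-- **(47) FOR THE RESTRICTED HEIGHT DENSITY OF THE v2 DATUM** (and the restricted density lies below the unrestricted one): for every run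
`K` and comparison height `n ≤ K`, almost everywhere on the window `PlaqSmall (θBal n)` of the comparison lattice,
`e^{−Ecst_k − Rm_k}·low_k(fieldShift V) ≤ heightDensity F γ _ (histGood … K n) V ≤ resDensity F γ K univ k (fieldShift V)`, `k = K − n` — the frame
`LogComparisonSmallFieldEnvelope.heightDensity_sandwich_of_oneStep` fed with the lower envelopes `ℓ_j := e^{−Ecst_j − Rm_j}·low_j` (one step:
`dataT3c_oneStep_lower`; base: the delivered `Ineq47AE` at `j = 0`) and the trivially propagating upper envelopes `u_j := resDensity … univ j`
(monotonicity of `T_j`).  Print's (47) p.267 for the term WITHOUT large fields, which is what the inductive proof establishes (p.272 L32–33).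
[cite: Balaban1985UV3, (47) p.267 + p.272 L32–33] -/
theorem dataT3c_restricted47 (K n : ℕ) (hK : n ≤ K) :
    ∀ᵐ V ∂fieldMeasure (F.P n) 0 (Matrix.specialUnitaryGroup (Fin 2) ℂ), PlaqSmall (θBal F.L γ 𝔠.b₀ 𝔠.p₀ n) V →
      Real.exp (-((h.dataT3c hc γ hγ hγ1 π).Ecst K (K - n)) - (h.dataT3c hc γ hγ hγ1 π).Rm K (K - n)) *
            (h.dataT3c hc γ hγ hγ1 π).low K (K - n)
              (fieldShift (F.sitesPerDir_eq (m := F.m) (K := K) (j := K - n) (m' := F.m) (K' := n) (j' := 0) (by omega)) V) ≤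
          heightDensity F γ hK (histGood F ℰp (θBal F.L γ 𝔠.b₀ 𝔠.p₀) K n) V ∧
        heightDensity F γ hK (histGood F ℰp (θBal F.L γ 𝔠.b₀ 𝔠.p₀) K n) V ≤
          resDensity F γ K Set.univ (K - n)
            (fieldShift (F.sitesPerDir_eq (m := F.m) (K := K) (j := K - n) (m' := F.m) (K' := n) (j' := 0) (by omega)) V) := by
  have hres0 : ∀ W : GaugeField (F.P K) 0 (Matrix.specialUnitaryGroup (Fin 2) ℂ),
      resDensity F γ K Set.univ 0 W = boltzmann (F.P K) ((F.scheme ℰp γ).β K) W := fun W => by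
    show Set.univ.indicator _ W = _
    rw [Set.indicator_univ]
  have hbase : ∀ᵐ W ∂fieldMeasure (F.P K) 0 (Matrix.specialUnitaryGroup (Fin 2) ℂ), PlaqSmall (θBal F.L γ 𝔠.b₀ 𝔠.p₀ K) W →
      (fun (j : ℕ) (W' : GaugeField (F.P K) j (Matrix.specialUnitaryGroup (Fin 2) ℂ)) =>
          Real.exp (-((h.dataT3c hc γ hγ hγ1 π).Ecst K j) - (h.dataT3c hc γ hγ hγ1 π).Rm K j) * (h.dataT3c hc γ hγ hγ1 π).low K j W') 0 W ≤
          boltzmann (F.P K) ((F.scheme ℰp γ).β K) W ∧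
        boltzmann (F.P K) ((F.scheme ℰp γ).β K) W ≤ (fun j => resDensity F γ K Set.univ j) 0 W := by
    filter_upwards [h.dataT3c_ineq47AE hc γ hγ hγ1 π K 0 (Nat.zero_le K)] with W hW _
    exact ⟨by rw [← hres0 W]; exact hW, (hres0 W).symm.le⟩
  have hstep : ∀ (j : ℕ) (hj : j + 1 ≤ K - n), ∀ᵐ W ∂fieldMeasure (F.P K) (j + 1) (Matrix.specialUnitaryGroup (Fin 2) ℂ),
      PlaqSmall (θBal F.L γ 𝔠.b₀ 𝔠.p₀ (K - (j + 1))) W →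
        (fun (j : ℕ) (W' : GaugeField (F.P K) j (Matrix.specialUnitaryGroup (Fin 2) ℂ)) =>
            Real.exp (-((h.dataT3c hc γ hγ hγ1 π).Ecst K j) - (h.dataT3c hc γ hγ hγ1 π).Rm K j) * (h.dataT3c hc γ hγ hγ1 π).low K j W')
            (j + 1) W ≤
          (rt F K j (by omega)).T ({W' | PlaqSmall (θBal F.L γ 𝔠.b₀ 𝔠.p₀ (K - j)) W'}.indicator
            ((fun (j : ℕ) (W' : GaugeField (F.P K) j (Matrix.specialUnitaryGroup (Fin 2) ℂ)) =>
              Real.exp (-((h.dataT3c hc γ hγ hγ1 π).Ecst K j) - (h.dataT3c hc γ hγ hγ1 π).Rm K j) * (h.dataT3c hc γ hγ hγ1 π).low K j W') j)) W ∧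
        (rt F K j (by omega)).T ({W' | PlaqSmall (θBal F.L γ 𝔠.b₀ 𝔠.p₀ (K - j)) W'}.indicator
            ((fun j => resDensity F γ K Set.univ j) j)) W ≤ (fun j => resDensity F γ K Set.univ j) (j + 1) W := by
    intro j hj
    have hj' : j + 1 ≤ F.m + K := by omega
    have h1 := dataT3c_oneStep_lower h hc γ hγ hγ1 π K j (by omega)
    have hχ : MeasurableSet {W' : GaugeField (F.P K) j (Matrix.specialUnitaryGroup (Fin 2) ℂ) |
        PlaqSmall (θBal F.L γ 𝔠.b₀ 𝔠.p₀ (K - j)) W'} := measurableSet_plaqSmall _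
    have hui : Integrable (resDensity F γ K Set.univ j) (fieldMeasure (F.P K) j (Matrix.specialUnitaryGroup (Fin 2) ℂ)) :=
      integrable_resDensity F K MeasurableSet.univ hγ.le (by omega)
    have hle : {W' : GaugeField (F.P K) j (Matrix.specialUnitaryGroup (Fin 2) ℂ) | PlaqSmall (θBal F.L γ 𝔠.b₀ 𝔠.p₀ (K - j)) W'}.indicator
          (resDensity F γ K Set.univ j) ≤ᵐ[fieldMeasure (F.P K) j (Matrix.specialUnitaryGroup (Fin 2) ℂ)] resDensity F γ K Set.univ j :=
      ae_of_all _ fun W' => Set.indicator_le_self' (fun _ _ => resDensity_nonneg F γ K _ j W') W'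
    have h2 := rt_mono_ae F K hj' (hui.indicator hχ) hui hle
    have hsucc : resDensity F γ K Set.univ (j + 1) = (rt F K j hj').T (resDensity F γ K Set.univ j) :=
      towerDensity_succ F K _ hj'
    filter_upwards [h1, h2] with W h1W h2W _
    refine ⟨h1W, ?_⟩
    show _ ≤ resDensity F γ K Set.univ (j + 1) W
    rw [hsucc]
    exact h2W
  exact heightDensity_sandwich_of_oneStep F hγ.le K (θBal F.L γ 𝔠.b₀ 𝔠.p₀)
    (fun (j : ℕ) (W' : GaugeField (F.P K) j (Matrix.specialUnitaryGroup (Fin 2) ℂ)) =>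
      Real.exp (-((h.dataT3c hc γ hγ hγ1 π).Ecst K j) - (h.dataT3c hc γ hγ hγ1 π).Rm K j) * (h.dataT3c hc γ hγ hγ1 π).low K j W')
    (fun j => resDensity F γ K Set.univ j) hK
    (fun j hj => (h.dataT3c_integrable_low hc γ hγ hγ1 π K j (by omega)).const_mul _)
    (fun j hj => integrable_resDensity F K MeasurableSet.univ hγ.le (by omega)) hbase hstep

end Restricted

/-! ## §6 The lower half of `RepAtHeights`'s a.e. clause in log form -/

section LogForm

variable {F : T3Family} {𝔠 : AlphaConsts F.L (suGroupModel 2).N} {a₀ a₁ : ℝ}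
  (h : AlphaInputsT3AC.OfV2At F 𝔠 a₀ a₁) (hc : 0 < a₀ ∧ 0 < a₁ ∧ 𝔠.B₃ * a₁ ≤ a₀) (γ : ℝ) (hγ : 0 < γ)
  (hγ1 : γ ≤ (min 𝔠.gamma0 1) ^ 2) (π : AlphaInputsT3AC.PolymerT3 F)

/-- **THE LOWER HALF OF THE TWO-SIDED REPRESENTATION, LOG FORM, GIVEN THE IDENTIFICATION OF THE MAIN TERM**: at a height `n ≤ K` where the
Wilson action of the composite minimiser at the trivial history IS print's regular background `minActionRegPr` on the window (`hid`; delivered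
below the cut-off by `dataT3c_uminTriv`, at the cut-off by `U_0(V, triv) = V`), almost everywhere on the window the restricted height density is
POSITIVE and `−D.RmH K n ≤ log ρ(V) + β_K·minActionRegPr F n K _ ε₀ V − D.PintH K n V + D.EcstH K n` — the (47)-direction of
`T3LogComparisonSocket.TwoSidedRepAt`'s inequality for the v2 datum's data. [cite: Balaban1985UV3, (47) p.267] -/
theorem dataT3c_repAtHeights_lower_of_id (K n : ℕ) (hK : n ≤ K) (ε₀ : ℝ)
    (hid : ∀ V : GaugeField (F.P n) 0 (Matrix.specialUnitaryGroup (Fin 2) ℂ), PlaqSmall (θBal F.L γ 𝔠.b₀ 𝔠.p₀ n) V →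
      wilsonAction4 ((h.dataT3c hc γ hγ hγ1 π).Umin K (K - n) ((h.dataT3c hc γ hγ hγ1 π).triv K (K - n))
        (fieldShift (F.sitesPerDir_eq (m := F.m) (K := K) (j := K - n) (m' := F.m) (K' := n) (j' := 0) (by omega)) V)) =
        minActionRegPr F n K hK ε₀ V) :
    ∀ᵐ V ∂fieldMeasure (F.P n) 0 (Matrix.specialUnitaryGroup (Fin 2) ℂ), PlaqSmall (θBal F.L γ 𝔠.b₀ 𝔠.p₀ n) V →
      0 < heightDensity F γ hK (histGood F ℰp (θBal F.L γ 𝔠.b₀ 𝔠.p₀) K n) V ∧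
        -((h.dataT3c hc γ hγ hγ1 π).RmH K n) ≤
          Real.log (heightDensity F γ hK (histGood F ℰp (θBal F.L γ 𝔠.b₀ 𝔠.p₀) K n) V) +
            (F.scheme ℰp γ).β K * minActionRegPr F n K hK ε₀ V - (h.dataT3c hc γ hγ hγ1 π).PintH K n V +
              (h.dataT3c hc γ hγ hγ1 π).EcstH K n := by
  have hup := F.sitesPerDir_eq (m := F.m) (K := K) (j := K - n) (m' := F.m) (K' := n) (j' := 0) (by omega)
  filter_upwards [dataT3c_restricted47 h hc γ hγ hγ1 π K n hK] with V hV hs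
  obtain ⟨hlow, -⟩ := hV hs
  -- the window factor is `1`
  have hsW : PlaqSmall (θBal F.L γ 𝔠.b₀ 𝔠.p₀ (K - (K - n))) (fieldShift hup V) := by
    rw [Nat.sub_sub_self hK]
    exact (plaqSmall_fieldShift F hup _ V).mpr hs
  have hχ : (h.dataT3c hc γ hγ hγ1 π).χ K (K - n) (fieldShift hup V) = 1 := by
    rw [h.dataT3c_chi_eq hc γ hγ hγ1 π K (K - n) (by omega)]
    unfold chiSmall
    exact if_pos (show PlaqSmallOn Set.univ (θBal F.L γ 𝔠.b₀ 𝔠.p₀ (K - (K - n))) (fieldShift hup V) from fun q _ => hsW q)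
  -- the main term is `β_K · minActionRegPr`
  have hmain : (h.dataT3c hc γ hγ hγ1 π).mainT K (K - n) ((h.dataT3c hc γ hγ hγ1 π).triv K (K - n)) (fieldShift hup V) =
      (F.scheme ℰp γ).β K * minActionRegPr F n K hK ε₀ V := by
    rw [h.dataT3c_mainTermIsAction hc γ hγ hγ1 π K (K - n) _ (fieldShift hup V), hid V hs]
  -- the interaction sum read at the height is `PintH`
  have hPint : (h.dataT3c hc γ hγ hγ1 π).Pint K (K - n) ((h.dataT3c hc γ hγ hγ1 π).triv K (K - n)) (fieldShift hup V) =
      (h.dataT3c hc γ hγ hγ1 π).PintH K n V := ((h.dataT3c hc γ hγ hγ1 π).PintH_of_le hK V).symm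
  have hlow' : Real.exp (-((h.dataT3c hc γ hγ hγ1 π).EcstH K n) - (h.dataT3c hc γ hγ hγ1 π).RmH K n +
        (-((F.scheme ℰp γ).β K * minActionRegPr F n K hK ε₀ V) + (h.dataT3c hc γ hγ hγ1 π).PintH K n V)) ≤
      heightDensity F γ hK (histGood F ℰp (θBal F.L γ 𝔠.b₀ 𝔠.p₀) K n) V := by
    have e : Real.exp (-((h.dataT3c hc γ hγ hγ1 π).Ecst K (K - n)) - (h.dataT3c hc γ hγ hγ1 π).Rm K (K - n)) *
        (h.dataT3c hc γ hγ hγ1 π).low K (K - n) (fieldShift hup V) =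
        Real.exp (-((h.dataT3c hc γ hγ hγ1 π).EcstH K n) - (h.dataT3c hc γ hγ hγ1 π).RmH K n +
          (-((F.scheme ℰp γ).β K * minActionRegPr F n K hK ε₀ V) + (h.dataT3c hc γ hγ hγ1 π).PintH K n V)) := by
      show _ * ((h.dataT3c hc γ hγ hγ1 π).χ K (K - n) (fieldShift hup V) * Real.exp _) = _
      rw [hχ, one_mul, hmain, hPint, ← Real.exp_add]
      rfl
    rw [← e]
    exact hlow
  have hpos : 0 < heightDensity F γ hK (histGood F ℰp (θBal F.L γ 𝔠.b₀ 𝔠.p₀) K n) V := lt_of_lt_of_le (Real.exp_pos _) hlow'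
  refine ⟨hpos, ?_⟩
  have hlog := Real.log_le_log (Real.exp_pos _) hlow'
  rw [Real.log_exp] at hlog
  linarith

/-- **BELOW THE CUT-OFF (`n < K`)**: under the adapter's thresholds `θBal(n) ≤ a₁`, `B₃θBal(n) ≤ ε₀ ≤ a₀` (the GIVEN constants of the record;
an adapter discharges them by `T3ThresholdSmallness` once `γ ≤ γ₁(ε₀)`), the minimiser row r1 (`dataT3c_uminTriv`) identifies the main term and
`dataT3c_repAtHeights_lower_of_id` applies: a.e. on the window, `ρ > 0` and `−RmH ≤ log ρ + β_K·minActionRegPr − PintH + EcstH`.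
[cite: Balaban1985UV3, (47) p.267; Balaban1985Variational, Thm 1 (8) p.279] -/
theorem dataT3c_repAtHeights_lower (K n : ℕ) (hnK : n < K) (ε₀ : ℝ)
    (ha₁ : θBal F.L γ 𝔠.b₀ 𝔠.p₀ n ≤ a₁) (hlo : 𝔠.B₃ * θBal F.L γ 𝔠.b₀ 𝔠.p₀ n ≤ ε₀) (hhi : ε₀ ≤ a₀) :
    ∀ᵐ V ∂fieldMeasure (F.P n) 0 (Matrix.specialUnitaryGroup (Fin 2) ℂ), PlaqSmall (θBal F.L γ 𝔠.b₀ 𝔠.p₀ n) V →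
      0 < heightDensity F γ hnK.le (histGood F ℰp (θBal F.L γ 𝔠.b₀ 𝔠.p₀) K n) V ∧
        -((h.dataT3c hc γ hγ hγ1 π).RmH K n) ≤
          Real.log (heightDensity F γ hnK.le (histGood F ℰp (θBal F.L γ 𝔠.b₀ 𝔠.p₀) K n) V) +
            (F.scheme ℰp γ).β K * minActionRegPr F n K hnK.le ε₀ V - (h.dataT3c hc γ hγ hγ1 π).PintH K n V +
              (h.dataT3c hc γ hγ hγ1 π).EcstH K n :=
  dataT3c_repAtHeights_lower_of_id h hc γ hγ hγ1 π K n hnK.le ε₀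
    fun V hV => (h.dataT3c_uminTriv hc γ hγ hγ1 π K n hnK ε₀ ha₁ hlo hhi V hV).2

/-- At the top level the composite minimiser at the trivial history is the datum itself: `A(U_j(V, triv)) = A(V)` for `j = 0` (written for a
general level `j = 0` and a level identification `fieldShift`, so that it applies at `j = K − K`). [cite: Balaban1985UV3, (42) p.266] -/
theorem wilsonAction4_umin_triv_of_eq_zero (K : ℕ) {j : ℕ} (e : j = 0) (hup : (F.P K).sitesPerDir j = (F.P K).sitesPerDir 0)
    (V : GaugeField (F.P K) 0 (Matrix.specialUnitaryGroup (Fin 2) ℂ)) :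
    wilsonAction4 ((h.dataT3c hc γ hγ hγ1 π).Umin K j ((h.dataT3c hc γ hγ hγ1 π).triv K j) (fieldShift hup V)) = wilsonAction4 V := by
  subst e
  show wilsonAction4 ((h.pkgAtV2 hc γ hγ hγ1 K).UkH 0 (Hist.triv (F.P K) 0) (fieldShift hup V)) = _
  rw [(h.pkgAtV2 hc γ hγ hγ1 K).hU0, T3LevelShift.fieldShift_refl]

/-- Print's regular minimum over the trivial fibre is the action of the datum: `minActionRegPr F K K _ ε₀ V = A(V)` for `V ∈ 𝔘(ε₀)` (both clauses
of [Balaban1985Variational] (2); the fibre `{Ū^0 = V}` is `{V}`, `T3DescentFibreTower.fibre_self`). [cite: Balaban1985Variational, (6) p.278] -/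
theorem minActionRegPr_self_of_regPr (K : ℕ) (ε₀ : ℝ) (V : GaugeField (F.P K) 0 (Matrix.specialUnitaryGroup (Fin 2) ℂ))
    (hV : RegPr F K K ε₀ V) : minActionRegPr F K K le_rfl ε₀ V = wilsonAction4 V := by
  have hmem : V ∈ regFibrePr F K K le_rfl ε₀ V := by
    refine (mem_regFibrePr_iff (F := F)).mpr ⟨?_, hV⟩
    rw [fibre_self]
    exact Set.mem_singleton V
  refine le_antisymm (minActionRegPr_le F hmem) ?_
  refine le_csInf ⟨_, ⟨V, hmem, rfl⟩⟩ ?_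
  rintro _ ⟨U, hU, rfl⟩
  have hUf := ((mem_regFibrePr_iff (F := F)).mp hU).1
  rw [fibre_self] at hUf
  obtain rfl := Set.mem_singleton_iff.mp hUf
  exact le_rfl

/-- **AT THE CUT-OFF (`n = K`)**: if the window sits inside print's regular space, `θBal(K) ≤ ε₀` and `4·θBal(K) < ε₀` (divergence clause from the
plaquette clause, `T3AvgDivergenceSplit.regPr_of_plaqSmall`), then a.e. on the window `ρ > 0` and `−RmH K K ≤ log ρ + β_K·minActionRegPr F K K _ ε₀ V
− PintH K K V + EcstH K K` (here `ρ = 𝟙·e^{−β_K A(V)}`, `U_0(V, triv) = V`, the regular fibre is `{V}`). [cite: Balaban1985UV3, (1) p.256 + (47) p.267] -/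
theorem dataT3c_repAtHeights_lower_top (K : ℕ) (ε₀ : ℝ) (hε : θBal F.L γ 𝔠.b₀ 𝔠.p₀ K ≤ ε₀) (h4 : 4 * θBal F.L γ 𝔠.b₀ 𝔠.p₀ K < ε₀) :
    ∀ᵐ V ∂fieldMeasure (F.P K) 0 (Matrix.specialUnitaryGroup (Fin 2) ℂ), PlaqSmall (θBal F.L γ 𝔠.b₀ 𝔠.p₀ K) V →
      0 < heightDensity F γ le_rfl (histGood F ℰp (θBal F.L γ 𝔠.b₀ 𝔠.p₀) K K) V ∧
        -((h.dataT3c hc γ hγ hγ1 π).RmH K K) ≤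
          Real.log (heightDensity F γ le_rfl (histGood F ℰp (θBal F.L γ 𝔠.b₀ 𝔠.p₀) K K) V) +
            (F.scheme ℰp γ).β K * minActionRegPr F K K le_rfl ε₀ V - (h.dataT3c hc γ hγ hγ1 π).PintH K K V +
              (h.dataT3c hc γ hγ hγ1 π).EcstH K K := by
  refine dataT3c_repAtHeights_lower_of_id h hc γ hγ hγ1 π K K le_rfl ε₀ fun V hV => ?_
  have hreg : RegPr F K K ε₀ V := by
    refine regPr_of_plaqSmall F hV ?_ ?_
    · show θBal F.L γ 𝔠.b₀ 𝔠.p₀ K ≤ ε₀ * ((F.L : ℝ)⁻¹) ^ (2 * (K - K))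
      rw [Nat.sub_self, mul_zero, pow_zero, mul_one]
      exact hε
    · rw [Nat.sub_self, mul_zero, pow_zero, mul_one]
      exact h4
  rw [minActionRegPr_self_of_regPr K ε₀ V hreg]
  exact wilsonAction4_umin_triv_of_eq_zero h hc γ hγ hγ1 π K (Nat.sub_self K) _ V

end LogForm


end Summit.QuantumFields.YangMills.Theorems.RepAtHeightsAdapter

end
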